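import Mathlib

/-!
# Crux `UniformPhotonSphereChannelsR` (K1R, stmt-FinalStateConjecture-14074), line
# `crum-peeling-recessive-tower` — stub `stub_qFormRecursion`: the exact q-form of one rung

The registered stub `stub_qFormRecursion` of the line's skeleton (continuation lead c2): pure
formal-power-series algebra behind the majorant induction (Theorem A) for the recessive
Riccati–Crum coefficient chain.  Fix a rung `k` with `λ := ℓ - k ≥ 2` and write, over `ℝ⟦X⟧`
(`X = w = M/r`),

* `ω = mk (Ω k)`, `ν = mk (Ω (k+1))` (the recessive Riccati variables `W_k = −(λ_k/r) ω_k(w)`),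
* `g = mk (G k) = 1/ω`, `h = mk (G (k+1)) = 1/ν` (the registered inversion clauses, `qfr_mul_eq_one`),
* the registered rung map = coefficient `n` of
  `(λ-1)² ν² + (λ-1)(1-2X)(ν + Xν′) = λ² ω² - λ(1-2X)(ω + Xω′)` (`qfr_rung_series`).

Multiplying by `g² h²` and using `(ω + Xω′) g² = g - Xg′` (from `(ωg)′ = 0`) gives
(★) `λ(λ - (1-2X)(g - Xg′)) h² - (λ-1)(1-2X) g² (h - Xh′) - (λ-1)² g² = 0` (`qfr_star`); substituting
`h = g(1 + Q)`, `Q := hω - 1`, `A := (1-2X)(g - Xg′) - 1` and cancelling `g²` in the integral domain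
`ℝ⟦X⟧` gives
(Q) `(λ-1)(2λ-1) Q + (λ-1)(1-2X) g (XQ′) + λ(λ-1) Q² = (2λ-1) A + (3λ-1) A Q + λ A Q²`
(`qfr_q_series`).  The five registered conclusions are `q 0 = 0`, coefficient `1` of (Q)
(`q 1 = -(2λ-1)/(λ(λ-1))`), coefficients `1` and `n ≥ 2` of `h = g (1 + Q)` (shift law and output
formula) and coefficient `n ≥ 2` of (Q) (the q-recursion), read off with the Cauchy-product formula
`qfr_coeff_mk_mul` and the Euler operator `X·d/dX` (`qfr_coeff_euler`, `qfr_euler_mul`), then peeled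
into the registered `Finset.Ico` shapes (`qfr_peel01`, `qfr_peel0`, `qfr_drop_top`, `qfr_sum_cast`).
All identities were validated coefficientwise in exact rationals on the true chain by the lead
(`calc/qform_lean_validate.py`).  No analysis and no inequalities live here.
-/

-- `Summit.<S>.<S>` repeats a namespace component by design (D-0017); off here as in the lakefile.
set_option linter.dupNamespace false

noncomputable section

namespace Summit.FinalStateConjecture.FinalStateConjecture.Theorems.CrumPeelingRecessiveTower

open PowerSeries

/-- Coefficient `n` of `mk a * ψ`, as a sum over `range (n + 1)`. -/
theorem qfr_coeff_mk_mul (a : ℕ → ℝ) (ψ : ℝ⟦X⟧) (n : ℕ) :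
    coeff n (mk a * ψ) = ∑ i ∈ Finset.range (n + 1), a i * coeff (n - i) ψ := by
  rw [coeff_mul, Finset.Nat.sum_antidiagonal_eq_sum_range_succ_mk]
  simp only [coeff_mk, Nat.succ_eq_add_one]

/-- Coefficient `n` of `mk a * mk b` (Cauchy product of the coefficient sequences). -/
theorem qfr_coeff_mk_mul_mk (a b : ℕ → ℝ) (n : ℕ) :
    coeff n (mk a * mk b) = ∑ i ∈ Finset.range (n + 1), a i * b (n - i) := by
  rw [qfr_coeff_mk_mul]
  simp only [coeff_mk]

/-- A convolution identity `Σ_{i ≤ n} a i * b (n - i) = [n = 0]` says `mk a * mk b = 1`. -/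
theorem qfr_mul_eq_one (a b : ℕ → ℝ)
    (h : ∀ n, ∑ i ∈ Finset.range (n + 1), a i * b (n - i) = if n = 0 then 1 else 0) :
    mk a * mk b = 1 := by
  ext n
  rw [qfr_coeff_mk_mul_mk, h, coeff_one]

/-- Coefficients of the Euler derivative `X · φ′`: `(X φ′)_n = n φ_n`. -/
theorem qfr_coeff_euler (φ : ℝ⟦X⟧) (n : ℕ) :
    coeff n (X * d⁄dX ℝ φ) = (n : ℝ) * coeff n φ := by
  rcases n with _ | m
  · simp
  · rw [coeff_succ_X_mul, coeff_derivative]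
    push_cast
    ring

/-- The Euler derivative of `mk a` is `mk (n ↦ n * a n)`. -/
theorem qfr_euler_mk (a : ℕ → ℝ) : X * d⁄dX ℝ (mk a) = mk fun n => (n : ℝ) * a n := by
  ext n
  rw [qfr_coeff_euler, coeff_mk, coeff_mk]

/-- Leibniz rule for the Euler derivative. -/
theorem qfr_euler_mul (φ ψ : ℝ⟦X⟧) :
    X * d⁄dX ℝ (φ * ψ) = φ * (X * d⁄dX ℝ ψ) + ψ * (X * d⁄dX ℝ φ) := by
  rw [Derivation.leibniz, smul_eq_mul, smul_eq_mul]
  ring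

/-- Coefficients of `(1 - 2X) F`: `F_n - 2 F_{n-1}` (no second term at `n = 0`). -/
theorem qfr_coeff_f_mul (F : ℝ⟦X⟧) (n : ℕ) :
    coeff n ((1 - 2 * X) * F) = coeff n F - 2 * if n = 0 then 0 else coeff (n - 1) F := by
  rw [sub_mul, one_mul, map_sub, mul_assoc, ← map_ofNat (C (R := ℝ)) 2, coeff_C_mul]
  rcases n with _ | m
  · simp
  · simp

/-- The shifted Euler coefficient: `[n ≠ 0] (a (n-1) + (n-1) a (n-1)) = n a (n-1)`. -/
theorem qfr_shift_aux (a : ℕ → ℝ) (n : ℕ) :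
    (if n = 0 then (0 : ℝ) else a (n - 1) + ((n - 1 : ℕ) : ℝ) * a (n - 1)) = (n : ℝ) * a (n - 1) := by
  rcases n with _ | m
  · simp
  · simp only [Nat.succ_ne_zero, if_false, Nat.add_sub_cancel]
    push_cast
    ring

/-- **The rung map as a power-series identity.**  The registered coefficient clause is
coefficient `n` of `(λ-1)² ν² + (λ-1)(1-2X)(ν + Xν′) = λ² ω² - λ (1-2X)(ω + Xω′)`. -/
theorem qfr_rung_series (lam : ℝ) (om nu : ℕ → ℝ)
    (h : ∀ n : ℕ, (lam - 1) ^ 2 * ∑ i ∈ Finset.range (n + 1), nu i * nu (n - i)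
        + (lam - 1) * (((n : ℝ) + 1) * nu n - 2 * (n : ℝ) * nu (n - 1))
        = lam ^ 2 * ∑ i ∈ Finset.range (n + 1), om i * om (n - i)
        - lam * (((n : ℝ) + 1) * om n - 2 * (n : ℝ) * om (n - 1))) :
    C ((lam - 1) ^ 2) * (mk nu * mk nu)
        + C (lam - 1) * ((1 - 2 * X) * (mk nu + X * d⁄dX ℝ (mk nu)))
      = C (lam ^ 2) * (mk om * mk om)
        - C lam * ((1 - 2 * X) * (mk om + X * d⁄dX ℝ (mk om))) := by
  set c := lam - 1 with hc
  ext n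
  simp only [map_add, map_sub, coeff_C_mul, qfr_coeff_mk_mul_mk, qfr_coeff_f_mul, qfr_coeff_euler,
    coeff_mk]
  rw [qfr_shift_aux nu n, qfr_shift_aux om n]
  linear_combination h n

/-- **(★).**  Multiplying the rung identity by `g² h²` (`g ω = 1`, `h ν = 1`) and using
`(ω + Xω′) g² = g - X g′` (from `(ωg)′ = 0`):
`λ (λ - (1-2X)(g - Xg′)) h² - (λ-1)(1-2X) g² (h - Xh′) - (λ-1)² g² = 0`. -/
theorem qfr_star (lam : ℝ) (ω ν g h : ℝ⟦X⟧) (e1 : g * ω = 1) (e2 : h * ν = 1)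
    (e3 : C ((lam - 1) ^ 2) * (ν * ν) + C (lam - 1) * ((1 - 2 * X) * (ν + X * d⁄dX ℝ ν))
      = C (lam ^ 2) * (ω * ω) - C lam * ((1 - 2 * X) * (ω + X * d⁄dX ℝ ω))) :
    C lam * (C lam - (1 - 2 * X) * (g - X * d⁄dX ℝ g)) * h ^ 2
      - (C lam - 1) * (1 - 2 * X) * g ^ 2 * (h - X * d⁄dX ℝ h) - (C lam - 1) ^ 2 * g ^ 2 = 0 := by
  have e4 : g * (X * d⁄dX ℝ ω) + ω * (X * d⁄dX ℝ g) = 0 := by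
    rw [← qfr_euler_mul, e1, Derivation.map_one_eq_zero, mul_zero]
  have e5 : h * (X * d⁄dX ℝ ν) + ν * (X * d⁄dX ℝ h) = 0 := by
    rw [← qfr_euler_mul, e2, Derivation.map_one_eq_zero, mul_zero]
  have s1 : (ω + X * d⁄dX ℝ ω) * g ^ 2 = g - X * d⁄dX ℝ g := by
    linear_combination (g - X * d⁄dX ℝ g) * e1 + g * e4
  have s1' : ω * ω * g ^ 2 = 1 := by linear_combination (ω * g + 1) * e1
  have s2 : (ν + X * d⁄dX ℝ ν) * h ^ 2 = h - X * d⁄dX ℝ h := by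
    linear_combination (h - X * d⁄dX ℝ h) * e2 + h * e5
  have s2' : ν * ν * h ^ 2 = 1 := by linear_combination (ν * h + 1) * e2
  simp only [map_pow, map_sub, map_one] at e3
  linear_combination (-(g ^ 2 * h ^ 2)) * e3 - C lam ^ 2 * h ^ 2 * s1'
    + C lam * (1 - 2 * X) * h ^ 2 * s1 + (C lam - 1) ^ 2 * g ^ 2 * s2'
    + (C lam - 1) * (1 - 2 * X) * g ^ 2 * s2

/-- **(Q).**  With `Q := h ω - 1` (so `h = g (1 + Q)`) and `A := (1-2X)(g - Xg′) - 1`, dividing (★)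
by `g²` (`g ≠ 0` in the integral domain `ℝ⟦X⟧`):
`(λ-1)(2λ-1) Q + (λ-1)(1-2X) g (XQ′) + λ(λ-1) Q² = (2λ-1) A + (3λ-1) A Q + λ A Q²`. -/
theorem qfr_q_series (lam : ℝ) (ω g h Q A : ℝ⟦X⟧) (e1 : g * ω = 1) (e6 : Q = h * ω - 1)
    (e7 : A = (1 - 2 * X) * (g - X * d⁄dX ℝ g) - 1) (hg : g ≠ 0)
    (hstar : C lam * (C lam - (1 - 2 * X) * (g - X * d⁄dX ℝ g)) * h ^ 2
      - (C lam - 1) * (1 - 2 * X) * g ^ 2 * (h - X * d⁄dX ℝ h) - (C lam - 1) ^ 2 * g ^ 2 = 0) :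
    C ((lam - 1) * (2 * lam - 1)) * Q + C (lam - 1) * ((1 - 2 * X) * (g * (X * d⁄dX ℝ Q)))
        + C (lam * (lam - 1)) * (Q * Q)
      = C (2 * lam - 1) * A + C (3 * lam - 1) * (A * Q) + C lam * (A * (Q * Q)) := by
  have s3 : h = g * (1 + Q) := by linear_combination (-h) * e1 - g * e6
  have d1 : X * d⁄dX ℝ (1 + Q) = X * d⁄dX ℝ Q := by
    rw [map_add, Derivation.map_one_eq_zero, zero_add]
  have s4 : X * d⁄dX ℝ h = g * (X * d⁄dX ℝ Q) + (1 + Q) * (X * d⁄dX ℝ g) := by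
    rw [s3, qfr_euler_mul, d1]
  rw [s4] at hstar
  rw [s3] at hstar
  rw [e7]
  simp only [map_mul, map_sub, map_ofNat, map_one]
  apply mul_left_cancel₀ (pow_ne_zero 2 hg)
  linear_combination hstar

/-- The coefficient sequence of `A := (1-2X)(g - Xg′) - 1`: `α 0 = 0`, `α 1 = -2`,
`α n = (1-n) G n + 2(n-2) G (n-1)` for `n ≥ 2` (given `G 0 = 1`). -/
theorem qfr_alpha (Gk α : ℕ → ℝ) (hG0 : Gk 0 = 1) (hα0 : α 0 = 0) (hα1 : α 1 = -2)
    (hα : ∀ n, 2 ≤ n → α n = (1 - (n : ℝ)) * Gk n + 2 * ((n : ℝ) - 2) * Gk (n - 1)) :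
    mk α = (1 - 2 * X) * (mk Gk - X * d⁄dX ℝ (mk Gk)) - 1 := by
  ext n
  simp only [map_sub, coeff_one, qfr_coeff_f_mul, qfr_coeff_euler, coeff_mk]
  rcases n with _ | _ | m
  · simp [hα0, hG0]
  · norm_num [hα1, hG0]
  · rw [hα (m + 2) (by omega), if_neg (by omega), if_neg (by omega)]
    simp only [show m + 2 - 1 = m + 1 by omega]
    push_cast
    ring

/-- **Coefficient `n` of (Q)**, for coefficient sequences `Gk, q, α` and scalars `c₁, …, c₆`. -/
theorem qfr_extract (c1 c2 c3 c4 c5 c6 : ℝ) (Gk q α : ℕ → ℝ)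
    (hQ : C c1 * mk q + C c2 * ((1 - 2 * X) * (mk Gk * (X * d⁄dX ℝ (mk q)))) + C c3 * (mk q * mk q)
      = C c4 * mk α + C c5 * (mk α * mk q) + C c6 * (mk α * (mk q * mk q))) (n : ℕ) :
    c1 * q n
      + c2 * (∑ i ∈ Finset.range (n + 1), Gk i * (((n - i : ℕ) : ℝ) * q (n - i))
          - 2 * if n = 0 then 0 else
              ∑ i ∈ Finset.range (n - 1 + 1), Gk i * (((n - 1 - i : ℕ) : ℝ) * q (n - 1 - i)))
      + c3 * ∑ i ∈ Finset.range (n + 1), q i * q (n - i)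
      = c4 * α n + c5 * ∑ i ∈ Finset.range (n + 1), α i * q (n - i)
        + c6 * ∑ i ∈ Finset.range (n + 1), α i
            * ∑ j ∈ Finset.range (n - i + 1), q j * q (n - i - j) := by
  have := congrArg (coeff n) hQ
  rw [qfr_euler_mk] at this
  simpa only [map_add, map_sub, coeff_C_mul, coeff_mk, qfr_coeff_f_mul, qfr_coeff_mk_mul_mk,
    qfr_coeff_mk_mul] using this

/-- Peeling the two bottom terms off a sum over `range (m + 2)`. -/
theorem qfr_peel01 (f : ℕ → ℝ) (m : ℕ) :
    ∑ i ∈ Finset.range (m + 2), f i = f 0 + f 1 + ∑ i ∈ Finset.Ico 2 (m + 2), f i := by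
  rw [Finset.range_eq_Ico, Finset.sum_eq_sum_Ico_succ_bot (by omega),
    Finset.sum_eq_sum_Ico_succ_bot (by omega)]
  ring

/-- Peeling the bottom term off a sum over `range (m + 1)`. -/
theorem qfr_peel0 (f : ℕ → ℝ) (m : ℕ) :
    ∑ i ∈ Finset.range (m + 1), f i = f 0 + ∑ i ∈ Finset.Ico 1 (m + 1), f i := by
  rw [Finset.range_eq_Ico, Finset.sum_eq_sum_Ico_succ_bot (by omega)]

/-- Dropping a vanishing top term of a sum over `Ico a (m + 1)`. -/
theorem qfr_drop_top (f : ℕ → ℝ) (a m : ℕ) (h : f m = 0) :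
    ∑ i ∈ Finset.Ico a (m + 1), f i = ∑ i ∈ Finset.Ico a m, f i := by
  by_cases ham : a ≤ m
  · rw [Finset.sum_Ico_succ_top ham, h, add_zero]
  · rw [Finset.Ico_eq_empty (by omega), Finset.Ico_eq_empty (by omega)]

/-- Rewriting `↑(n - i)` as a real difference inside a sum over `Ico a n`. -/
theorem qfr_sum_cast (G q : ℕ → ℝ) (a n : ℕ) (c : ℝ) (hc : c = n) :
    ∑ i ∈ Finset.Ico a n, G i * (((n - i : ℕ) : ℝ) * q (n - i))
      = ∑ i ∈ Finset.Ico a n, G i * (c - i) * q (n - i) := by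
  refine Finset.sum_congr rfl fun i hi => ?_
  rw [Finset.mem_Ico] at hi
  rw [Nat.cast_sub hi.2.le, hc]
  ring

/-- **Stub `stub_qFormRecursion`** (line `crum-peeling-recessive-tower`, crux K1R): the exact
q-form of one rung of the recessive Riccati–Crum coefficient chain.  With `λ = ℓ - k ≥ 2`,
`g = Σ G k n wⁿ = 1/ω_k`, `h = Σ G (k+1) n wⁿ = 1/ω_{k+1}` and `q := h ω_k - 1` (so `h = g (1 + q)`),
the registered rung map is equivalent to the power-series identity (Q)
`(λ-1)(2λ-1) q + (λ-1)(1-2w) g (w q′) + λ(λ-1) q² = (2λ-1) α + (3λ-1) α q + λ α q²`,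
`α = (1-2w)(g - w g′) - 1`; its coefficients `1` and `n ≥ 2`, together with the coefficients of
`h = g (1 + q)`, are the five registered conclusions. -/
theorem stub_qFormRecursion :
    ∀ (ℓ k : ℕ), k + 2 ≤ ℓ → ∀ (Ω G : ℕ → ℕ → ℝ),
      Ω k 0 = 1 → Ω (k + 1) 0 = 1 → G k 0 = 1 → G (k + 1) 0 = 1 →
      (∀ n, ∑ i ∈ Finset.range (n + 1), G k i * Ω k (n - i) = if n = 0 then 1 else 0) →
      (∀ n, ∑ i ∈ Finset.range (n + 1), G (k + 1) i * Ω (k + 1) (n - i) = if n = 0 then 1 else 0) →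
      (∀ n, ((ℓ : ℝ) - k - 1) ^ 2 * ∑ i ∈ Finset.range (n + 1), Ω (k + 1) i * Ω (k + 1) (n - i)
          + ((ℓ : ℝ) - k - 1) * (((n : ℝ) + 1) * Ω (k + 1) n - 2 * (n : ℝ) * Ω (k + 1) (n - 1))
          = ((ℓ : ℝ) - k) ^ 2 * ∑ i ∈ Finset.range (n + 1), Ω k i * Ω k (n - i)
          - ((ℓ : ℝ) - k) * (((n : ℝ) + 1) * Ω k n - 2 * (n : ℝ) * Ω k (n - 1))) →
      ∀ (q α : ℕ → ℝ),
        (∀ n, q n = (∑ i ∈ Finset.range (n + 1), G (k + 1) i * Ω k (n - i)) - if n = 0 then 1 else 0) →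
        α 0 = 0 → α 1 = -2 →
        (∀ n, 2 ≤ n → α n = (1 - (n : ℝ)) * G k n + 2 * ((n : ℝ) - 2) * G k (n - 1)) →
        q 0 = 0 ∧
        q 1 = -((2 * ((ℓ : ℝ) - k) - 1) / (((ℓ : ℝ) - k) * (((ℓ : ℝ) - k) - 1))) ∧
        G (k + 1) 1 = G k 1 - (2 * ((ℓ : ℝ) - k) - 1) / (((ℓ : ℝ) - k) * (((ℓ : ℝ) - k) - 1)) ∧
        (∀ n, 2 ≤ n → G (k + 1) n
            = G k n + q n + G k 1 * q (n - 1) + ∑ i ∈ Finset.Ico 2 n, G k i * q (n - i)) ∧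
        (∀ n, 2 ≤ n →
          (((ℓ : ℝ) - k) - 1) * (2 * ((ℓ : ℝ) - k) - 1 + n) * q n
            = (2 * ((ℓ : ℝ) - k) - 1) * α n
              - (((ℓ : ℝ) - k) - 1) * G k 1 * ((n : ℝ) - 1) * q (n - 1)
              - (((ℓ : ℝ) - k) - 1) * ∑ i ∈ Finset.Ico 2 n, G k i * ((n : ℝ) - i) * q (n - i)
              + 2 * (((ℓ : ℝ) - k) - 1) * (((n : ℝ) - 1) * q (n - 1) + G k 1 * ((n : ℝ) - 2) * q (n - 2)
                  + ∑ i ∈ Finset.Ico 2 (n - 1), G k i * ((n : ℝ) - 1 - i) * q (n - 1 - i))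
              - ((ℓ : ℝ) - k) * (((ℓ : ℝ) - k) - 1) * ∑ i ∈ Finset.Ico 1 n, q i * q (n - i)
              + (3 * ((ℓ : ℝ) - k) - 1) * ∑ i ∈ Finset.Ico 1 n, α i * q (n - i)
              + ((ℓ : ℝ) - k) * ∑ i ∈ Finset.Ico 1 (n - 1), α i * ∑ j ∈ Finset.Ico 1 (n - i), q j * q (n - i - j)) := by
  intro ℓ k hkl Ω G hΩ0 hΩ1 hG0 hG1 hinv hinv1 hbig q α hq hα0 hα1 hα
  -- the rung parameter `λ = ℓ - k ≥ 2`
  set lam : ℝ := (ℓ : ℝ) - k with hlam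
  have hlam2 : (2 : ℝ) ≤ lam := by
    have h' : ((k + 2 : ℕ) : ℝ) ≤ ℓ := by exact_mod_cast hkl
    push_cast at h'
    rw [hlam]
    linarith
  have hl0 : lam ≠ 0 := ne_of_gt (by linarith)
  have hl1 : lam - 1 ≠ 0 := ne_of_gt (by linarith)
  have hq0 : q 0 = 0 := by rw [hq 0]; simp [hG1, hΩ0]
  -- the power series `g = mk (G k)`, `h = mk (G (k+1))`, `ω = mk (Ω k)`, `ν = mk (Ω (k+1))`
  have e1 : mk (G k) * mk (Ω k) = 1 := qfr_mul_eq_one _ _ hinv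
  have e2 : mk (G (k + 1)) * mk (Ω (k + 1)) = 1 := qfr_mul_eq_one _ _ hinv1
  have e3 := qfr_rung_series lam (Ω k) (Ω (k + 1)) hbig
  have e6 : mk q = mk (G (k + 1)) * mk (Ω k) - 1 := by
    ext n
    rw [map_sub, qfr_coeff_mk_mul_mk, coeff_one, coeff_mk, hq n]
  have e7 := qfr_alpha (G k) α hG0 hα0 hα1 hα
  have hg : mk (G k) ≠ 0 := fun h0 => by
    have h00 := PowerSeries.ext_iff.mp h0 0
    rw [coeff_mk, map_zero, hG0] at h00
    exact one_ne_zero h00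
  have hstar := qfr_star lam (mk (Ω k)) (mk (Ω (k + 1))) (mk (G k)) (mk (G (k + 1))) e1 e2 e3
  have hQ := qfr_q_series lam (mk (Ω k)) (mk (G k)) (mk (G (k + 1))) (mk q) (mk α) e1 e6 e7 hg hstar
  have hQn := qfr_extract _ _ _ _ _ _ (G k) q α hQ
  -- `h = g (1 + q)`, coefficientwise
  have s3 : mk (G (k + 1)) = mk (G k) * (1 + mk q) := by
    linear_combination (-(mk (G (k + 1)))) * e1 - mk (G k) * e6
  have hH : ∀ n, G (k + 1) n
      = ∑ i ∈ Finset.range (n + 1), G k i * ((if n - i = 0 then (1 : ℝ) else 0) + q (n - i)) := by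
    intro n
    have hn := congrArg (coeff n) s3
    simpa only [coeff_mk, qfr_coeff_mk_mul, map_add, coeff_one] using hn
  -- order 1
  have hq1 : lam * (lam - 1) * q 1 = -(2 * lam - 1) := by
    have h1 := hQn 1
    norm_num [Finset.sum_range_succ, hq0, hα0, hα1, hG0] at h1
    linear_combination (1 / 2 : ℝ) * h1
  have hc2 : q 1 = -((2 * lam - 1) / (lam * (lam - 1))) := by
    field_simp
    linear_combination hq1
  refine ⟨hq0, hc2, ?_, ?_, ?_⟩
  · -- the shift law: coefficient 1 of `h = g (1 + q)`
    have h1 := hH 1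
    norm_num [Finset.sum_range_succ, hq0, hG0] at h1
    rw [h1, hc2]
    ring
  · -- the output formula: coefficient `n ≥ 2` of `h = g (1 + q)`
    intro n hn
    obtain ⟨m, rfl⟩ : ∃ m, n = m + 2 := ⟨n - 2, by omega⟩
    have hmid : ∑ i ∈ Finset.Ico 2 (m + 2), G k i * ((if m + 2 - i = 0 then (1 : ℝ) else 0) + q (m + 2 - i))
        = ∑ i ∈ Finset.Ico 2 (m + 2), G k i * q (m + 2 - i) := by
      refine Finset.sum_congr rfl fun i hi => ?_
      rw [Finset.mem_Ico] at hi
      rw [if_neg (by omega), zero_add]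
    rw [hH (m + 2), qfr_peel01, Finset.sum_Ico_succ_top (by omega : 2 ≤ m + 2), hmid,
      if_neg (by omega), if_neg (by omega), if_pos (by omega)]
    simp only [show m + 2 - 1 = m + 1 by omega, Nat.sub_zero, Nat.sub_self, hG0, hq0]
    ring
  · -- the q-recursion: coefficient `n ≥ 2` of (Q)
    intro n hn
    obtain ⟨m, rfl⟩ : ∃ m, n = m + 2 := ⟨n - 2, by omega⟩
    have h2 := hQn (m + 2)
    rw [if_neg (by omega)] at h2
    simp only [show m + 2 - 1 = m + 1 by omega] at h2 ⊢
    simp only [show m + 2 - 2 = m by omega]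
    have b1 : ∑ i ∈ Finset.range (m + 2 + 1), G k i * (((m + 2 - i : ℕ) : ℝ) * q (m + 2 - i))
        = ((m + 2 : ℕ) : ℝ) * q (m + 2) + G k 1 * (((m + 2 : ℕ) : ℝ) - 1) * q (m + 1)
          + ∑ i ∈ Finset.Ico 2 (m + 2), G k i * (((m + 2 : ℕ) : ℝ) - i) * q (m + 2 - i) := by
      rw [qfr_peel01, qfr_drop_top _ 2 (m + 2) (by simp),
        qfr_sum_cast (G k) q 2 (m + 2) ((m + 2 : ℕ) : ℝ) rfl]
      simp only [show m + 2 - 1 = m + 1 by omega, Nat.sub_zero, hG0]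
      push_cast
      ring
    have b2 : ∑ i ∈ Finset.range (m + 1 + 1), G k i * (((m + 1 - i : ℕ) : ℝ) * q (m + 1 - i))
        = (((m + 2 : ℕ) : ℝ) - 1) * q (m + 1) + G k 1 * (((m + 2 : ℕ) : ℝ) - 2) * q m
          + ∑ i ∈ Finset.Ico 2 (m + 1), G k i * (((m + 2 : ℕ) : ℝ) - 1 - i) * q (m + 1 - i) := by
      rw [qfr_peel01, qfr_drop_top _ 2 (m + 1) (by simp),
        qfr_sum_cast (G k) q 2 (m + 1) (((m + 2 : ℕ) : ℝ) - 1) (by push_cast; ring)]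
      simp only [Nat.add_sub_cancel, Nat.sub_zero, hG0]
      push_cast
      ring
    have b3 : ∑ i ∈ Finset.range (m + 2 + 1), q i * q (m + 2 - i)
        = ∑ i ∈ Finset.Ico 1 (m + 2), q i * q (m + 2 - i) := by
      rw [qfr_peel0, qfr_drop_top _ 1 (m + 2) (by simp [hq0]), hq0, zero_mul, zero_add]
    have b4 : ∑ i ∈ Finset.range (m + 2 + 1), α i * q (m + 2 - i)
        = ∑ i ∈ Finset.Ico 1 (m + 2), α i * q (m + 2 - i) := by
      rw [qfr_peel0, qfr_drop_top _ 1 (m + 2) (by simp [hq0]), hα0, zero_mul, zero_add]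
    have b5 : ∑ i ∈ Finset.range (m + 2 + 1), α i
          * ∑ j ∈ Finset.range (m + 2 - i + 1), q j * q (m + 2 - i - j)
        = ∑ i ∈ Finset.Ico 1 (m + 1), α i
          * ∑ j ∈ Finset.Ico 1 (m + 2 - i), q j * q (m + 2 - i - j) := by
      rw [qfr_peel0, qfr_drop_top _ 1 (m + 2) (by simp [hq0]),
        qfr_drop_top _ 1 (m + 1) (by simp [show m + 2 - (m + 1) = 1 by omega, Finset.sum_range_succ, hq0]),
        hα0, zero_mul, zero_add]
      refine Finset.sum_congr rfl fun i hi => ?_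
      rw [qfr_peel0, qfr_drop_top _ 1 (m + 2 - i) (by simp [hq0]), hq0, zero_mul, zero_add]
    rw [b1, b2, b3, b4, b5] at h2
    push_cast at h2 ⊢
    linear_combination h2

end Summit.FinalStateConjecture.FinalStateConjecture.Theorems.CrumPeelingRecessiveTower
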